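import Summits.Ventures.QEC.Census.CertBZPlane
import HarnessLib

/-!
# Lane-parallel replay of a Brouwer–Zimmermann matrix — soundness I: lane isolation
# (`Census/CertBZPlane.lean` definitions; this file and its three sequels are theorems only)

PACKING README (director-qec R16 (iii)).
1. A LANE FAMILY is `(N, χ)`: `N` lanes; `χ_j : ℕ` is the indicator word of row `j` — bit `b` of `χ_j` = "row `j` is in
   the selection of lane `b`". Lane `b`'s selection is the SET `{j : bit b of χ_j}`; nothing else is stored per lane.
2. WORD LAYOUT: lane `b` lives at bit position `b` of EVERY word (`χ_j`, planes, counter levels, masks). There are no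
   multi-bit fields, hence no carries: the only per-lane operations are `Nat.land / Nat.lor / Nat.xor`, and
   `Nat.testBit_and/or/xor` say bit `b` of the result depends on bit `b` of the operands alone.
3. CONCATENATION of families (`zipLorShift N A B`: `a_j ||| (b_j <<< N)`) is the only place two families share a
   word: if every `a_j < 2^N` then bits `< N` read `A` (`testBit_zipLorShift_lo`) and bits `N + b` read `B`
   (`testBit_zipLorShift_hi`) — the NO-OVERLAP invariant, carried as `Bnd` ("all words `< 2^N`", `zipLorShift_lt`,
   `bnd_concat`), with the lane transports `covers_concat_left` / `covers_concat_right`.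
Sequels: `CertBZPlaneCover.lean` (the colex triangle / segments cover every selection by its largest row),
`CertBZPlaneCount.lean` (planes = codeword coordinates, threshold counter, straggler loop), `CertBZPlaneSound.lean`
(assembly into the tree's `Reaches …` / `matrixEnumOK`). Axioms standard throughout.
-/

namespace Summit.Ventures.QEC.Census.Plane

open List

/-! ## Raw primitives = notation -/

/-- `ones N` is `2^N − 1`. -/
theorem ones_eq (N : ℕ) : ones N = 2 ^ N - 1 := rfl
/-- Raw `Nat.pow` is `^`. -/
theorem pow_eq (k : ℕ) : Nat.pow 2 k = 2 ^ k := rfl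
/-- Raw `Nat.xor` is `^^^`. -/
theorem natXor_eq (a b : ℕ) : Nat.xor a b = a ^^^ b := rfl
/-- Raw `Nat.lor` is `|||`. -/
theorem natLor_eq (a b : ℕ) : Nat.lor a b = a ||| b := rfl

/-- `bitAt` is `Nat.testBit`. -/
theorem bitAt_eq (x b : ℕ) : bitAt x b = x.testBit b := by
  unfold bitAt
  change Nat.beq ((x >>> b) &&& 1) 1 = x.testBit b
  rw [Nat.testBit_eq_decide_div_mod_eq, Nat.shiftRight_eq_div_pow, Nat.and_one_is_mod]
  generalize x / 2 ^ b % 2 = r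
  by_cases h : r = 1
  · subst h; rfl
  · rw [decide_eq_false h]
    cases hb : Nat.beq r 1
    · rfl
    · exact absurd (Nat.eq_of_beq_eq_true hb) h

/-- `Nat.beq F 0 = true` iff `F = 0`. -/
theorem beq_zero_iff (F : ℕ) : Nat.beq F 0 = true ↔ F = 0 :=
  ⟨Nat.eq_of_beq_eq_true, fun h => by subst h; rfl⟩

/-! ## Lane isolation: concatenated families never overlap

The only word operations of the engine are bitwise (`land/lor/xor`: bit `b` of the result depends on bit `b` of
the arguments only — `Nat.testBit_land/lor/xor`) and concatenation by `shiftLeft`: a family whose words are `< 2^N`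
occupies bits `< N`, the appended family is shifted to bits `≥ N`. These two lemmas are the whole "no carry, no
overlap" content (R16 (iii)). -/

/-- Entries of `shiftAll`. -/
theorem getD_shiftAll (N : ℕ) : ∀ (bs : List ℕ) (j : ℕ), (shiftAll N bs).getD j 0 = (bs.getD j 0) <<< N
  | [], j => by simp [shiftAll]
  | b :: bs, 0 => by simp [shiftAll]
  | b :: bs, j + 1 => by simp only [shiftAll, List.getD_cons_succ]; exact getD_shiftAll N bs j

/-- Entries of `zipLorShift`: `a_j ||| (b_j <<< N)` (missing entries `0`). -/
theorem getD_zipLorShift (N : ℕ) :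
    ∀ (as bs : List ℕ) (j : ℕ), (zipLorShift N as bs).getD j 0 = (as.getD j 0) ||| ((bs.getD j 0) <<< N)
  | [], bs, j => by rw [zipLorShift, getD_shiftAll]; simp
  | a :: as, [], 0 => by simp [zipLorShift]
  | a :: as, [], j + 1 => by
    simp only [zipLorShift, List.getD_cons_succ]; rw [getD_zipLorShift N as [] j]; simp
  | a :: as, b :: bs, 0 => by simp [zipLorShift]
  | a :: as, b :: bs, j + 1 => by
    simp only [zipLorShift, List.getD_cons_succ]; exact getD_zipLorShift N as bs j

/-- **Lane isolation, low part**: below `N`, the concatenation reads the FIRST family. -/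
theorem testBit_zipLorShift_lo (N : ℕ) (as bs : List ℕ) (j : ℕ) {b : ℕ} (hb : b < N) :
    ((zipLorShift N as bs).getD j 0).testBit b = (as.getD j 0).testBit b := by
  rw [getD_zipLorShift, Nat.testBit_or, Nat.testBit_shiftLeft]
  have : ¬ (b ≥ N) := by omega
  simp [this]

/-- **Lane isolation, high part**: if the first family's words are `< 2^N`, then from `N` on the concatenation
reads the SECOND family. -/
theorem testBit_zipLorShift_hi (N : ℕ) (as bs : List ℕ) (hN : ∀ j, as.getD j 0 < 2 ^ N) (j b : ℕ) :
    ((zipLorShift N as bs).getD j 0).testBit (N + b) = (bs.getD j 0).testBit b := by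
  rw [getD_zipLorShift, Nat.testBit_or, Nat.testBit_shiftLeft]
  have h1 : (as.getD j 0).testBit (N + b) = false :=
    Nat.testBit_lt_two_pow (lt_of_lt_of_le (hN j) (Nat.pow_le_pow_right (by norm_num) (by omega)))
  rw [h1, Bool.false_or]
  simp

/-- Words of a concatenation are bounded by `2^(N+M)`. -/
theorem zipLorShift_lt (N M : ℕ) (as bs : List ℕ) (hN : ∀ j, as.getD j 0 < 2 ^ N) (hM : ∀ j, bs.getD j 0 < 2 ^ M)
    (j : ℕ) : (zipLorShift N as bs).getD j 0 < 2 ^ (N + M) := by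
  rw [getD_zipLorShift]
  apply Nat.or_lt_two_pow
  · exact lt_of_lt_of_le (hN j) (Nat.pow_le_pow_right (by norm_num) (by omega))
  · rw [Nat.shiftLeft_eq, Nat.pow_add, Nat.mul_comm (2 ^ N)]
    exact Nat.mul_lt_mul_of_lt_of_le (hM j) le_rfl (Nat.two_pow_pos N)

/-- Length of a concatenation. -/
theorem length_zipLorShift (N : ℕ) : ∀ (as bs : List ℕ), (zipLorShift N as bs).length = max as.length bs.length
  | [], bs => by
    rw [zipLorShift]
    induction bs with
    | nil => rfl
    | cons b bs ih => simp [shiftAll, ih]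
  | a :: as, [] => by simp [zipLorShift, length_zipLorShift N as []]
  | a :: as, b :: bs => by simp [zipLorShift, length_zipLorShift N as bs, Nat.succ_max_succ]

/-- `ones N < 2^N`. -/
theorem ones_lt (N : ℕ) : ones N < 2 ^ N := by
  rw [ones_eq]; exact Nat.sub_lt (Nat.two_pow_pos N) Nat.one_pos

/-- Bits of `ones N`. -/
theorem testBit_ones (N b : ℕ) : (ones N).testBit b = decide (b < N) := by
  rw [ones_eq, Nat.testBit_two_pow_sub_one]

/-- Entries of `l ++ [x]`. -/
theorem getD_append_single (l : List ℕ) (x : ℕ) (j : ℕ) :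
    (l ++ [x]).getD j 0 = if j < l.length then l.getD j 0 else if j = l.length then x else 0 := by
  simp only [List.getD_eq_getElem?_getD]
  split
  · rw [List.getElem?_append_left (by assumption)]
  · split
    · subst_vars; simp
    · rw [List.getElem?_append_right (by omega)]
      have : j - l.length ≠ 0 := by omega
      obtain ⟨k, hk⟩ := Nat.exists_eq_succ_of_ne_zero this
      simp [hk]

/-! ## Coverage: a family COVERS an index list `J` if some lane's members are exactly `J` -/

/-- Concatenating two families covers what either covers (first family bounded). -/
theorem covers_concat_left {Na : ℕ} {Xa : List ℕ} (Nb : ℕ) (Xb : List ℕ) {J : List ℕ}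
    (h : Covers (Na, Xa) J) : Covers (Na + Nb, zipLorShift Na Xa Xb) J := by
  obtain ⟨b, hb, hJ⟩ := h
  refine ⟨b, by simp only at hb ⊢; omega, fun j => ?_⟩
  rw [testBit_zipLorShift_lo Na Xa Xb j hb]
  exact hJ j

/-- Concatenating two families covers what the second covers, `N_a` lanes further up (first family bounded). -/
theorem covers_concat_right (Na : ℕ) (Xa : List ℕ) {Nb : ℕ} {Xb : List ℕ} (hA : Bnd (Na, Xa)) {J : List ℕ}
    (h : Covers (Nb, Xb) J) : Covers (Na + Nb, zipLorShift Na Xa Xb) J := by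
  obtain ⟨b, hb, hJ⟩ := h
  refine ⟨Na + b, by simp only at hb ⊢; omega, fun j => ?_⟩
  rw [testBit_zipLorShift_hi Na Xa Xb (fun j => hA j) j b]
  exact hJ j

/-- The concatenation of bounded families is bounded (by `2^(N_a+N_b)`). -/
theorem bnd_concat {Na Nb : ℕ} {Xa Xb : List ℕ} (hA : Bnd (Na, Xa)) (hB : Bnd (Nb, Xb)) :
    Bnd (Na + Nb, zipLorShift Na Xa Xb) := fun j => zipLorShift_lt Na Nb Xa Xb hA hB j

end Summit.Ventures.QEC.Census.Plane
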